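import Summits.QuantumFields.BalabanUV.Beta.SymSecondOrderDeltaSep
import Summits.QuantumFields.BalabanUV.Beta.CombSecondOrderClassBase

/-!
# `BalabanUV.Beta.CombSecondOrderDeltaSep` — binder row D1, RULING R-D1-g35-1 (chart (III′)), programme P6 (localisation tail): **THE (III′) TWIN OF `SymSecondOrderDeltaSep`** — the same
# localisation∕class bookkeeping for the chart-(III′) remainder tables `combR2An1`∕`combΔAn1` (`CombSecondOrderRemainderAn1`) at the comb-chart resolvents `GcombSh Lc j`;
# ONLY the literal instances are twinned (`Gsym ↦ GcombSh`, `decays_Gsym ↦ decays_GcombSh`, `symΔOfAt`∕`symR2An1`∕`symΔAn1` ↦ `combΔOfAt`∕`combR2An1`∕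
# `combΔAn1`): the resolvent-generic §1 `sep_conjW_word`, §2 `sep_diagK_sharpSymbol` and `sep_zeroTable` of `SymSecondOrderDeltaSep`, the separation
# combinators of `SymSecondOrderClassStep` and `SymSecondOrderSplitLoc` §1∕§5 are IMPORTED AND REUSED BY NAME, not restated.
# * §3 `comb_letters_common`, `combΔOfAt_eq_sharp` — one common rate for the chart-(III′) letters; the explicit form of the split defect.
# * §4 `sep_combΔAn1_of_classes` — the Δ-half of the class step.  §5 `classes_combR2An1_combΔAn1`, `locStencil₂_combR2An1`, `sep_combΔAn1`,
#   `loc_combΔAn1`, and ROOT M″'s binder `hΔL_pinned` (at the pin `X2s := 0`, unconditionally).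

HONEST FRAMING (cell contract, verbatim): «discharging `BetaPertH` makes Bałaban's UV stability UNCONDITIONAL — a real constructive-QFT
result; it is NOT the continuum limit and NOT the Clay problem.»  HONEST DEPENDENCY: continuum YM on T⁴ ⇐ BetaPertH ∧ nine spine estimates (0/9 proved);
BetaPertH ⇐ (D1) ∧ (D4) ∧ CAP+tail; G-an2-4 gates asym, D1 and NE2/3/4.  DERIVED cell leaf ([folklore] BY NAME; β sub-cell, row-D1 OWNER `b2b-balaban-beta-an2` gen 36;
chart (II) original by the D1 formalisation swarm leaf-03∕leaf-10 and the owner).  No statement of Bałaban's papers, no `[cite:]`, no `Prop` fact, no `def`.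
RECORD = ROOT M′ p303989 (chart (II)) unchanged; NOT D1, NOT `BetaPertH`, NOT continuum, NOT Clay.
Provenance: β sub-cell, unit beta-an2 gen 36 (v1 draft, text-transformed) ∕ gen 37 (v2: generic lemmas imported, 2026-08-22); no existing file touched.
-/

noncomputable section

open Finset
open scoped BigOperators
open Literature.MathematicalPhysics.QuantumFieldTheory
open Literature.MathematicalPhysics.QuantumFieldTheory.Balaban1983to89
open Literature.MathematicalPhysics.QuantumFieldTheory.Balaban1983to89.Beta
open B12Sec2to5 (l1 l1_nonneg)
open ExpKernelCalculus (MKer Decays BiLoc VertexFamily comp l1_sub_symm)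
open PolarizationSign (reflSign)
open KernelReflection (refK)
open ResolventReflection (bref Φ)
open KernelWard (biLoc_add biLoc_sub)
open AveragingContoursRooted (ctr ctrOff ctrOff_mem_box)
open OneStepResolventKernel (Fib LocStencil biLoc_mono decays_mono)
open OneStepKernelFamily (colH vertexOfK)
open BalabanStepJetsSucc (wVH)
open BalabanStepW2 (M2Of wV4 wB2 locStencilFM_M2Of)
open BalabanCompositeJets (LocStencil₂)
open SecondOrderResponse (dM K2OfK vertex2OfK mixOfK W2OfK LocStencilFM)
open WilsonVertex2Sym (wsym22)
open Summit.QuantumFields.BalabanUV.Beta.TameKernelCalculus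
open Summit.QuantumFields.BalabanUV.Beta.ChartConjugation (conjV conjW conjW₁ conjW₂)
open Summit.QuantumFields.BalabanUV.Beta.AxialDressingRooted (one_le_of_neZero)
open Summit.QuantumFields.BalabanUV.Beta.BorderedHessian (bhK diagK spr_bhK)
open Summit.QuantumFields.BalabanUV.Beta.SecondOrderSplitDecay (diagK_dressed_eq_vertexOfK W2OfK_sharp_split_of_decay)
open Summit.QuantumFields.BalabanUV.Beta.SecondOrderSplitLoc (diagK_add' diagK_dressed₂_eq_vertex2OfK)
open Summit.QuantumFields.BalabanUV.Beta.SecondOrderRemainderTables (abs_le_of_locStencil₂ abs_le_of_locStencilFM W2OfK_add_slot₂)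
open Summit.QuantumFields.BalabanUV.Beta.SecondOrderSeparationCalculus (sep_of_le sep_add sep_neg sep_swap sep_conjV sep_dM_of_vertexFamily
  sep_vertexOfK_diag_of_vertexFamily sep_vertex2OfK sep_mixOfK sep_mixOfK_swap vertexFamily_dressedGen vertexFamily_conjV vertexFamily_Xi
  vertexFamily_K2OfK_add_Xi)
open Summit.QuantumFields.BalabanUV.Beta.SecondOrderDefectWordsSep (sep_comp_vertexFamily vertexFamily_dM' vertexFamily_comp_decays_right)
open Summit.QuantumFields.BalabanUV.Beta.SymSecondOrderClassStep (sep_comp_decays_left sep_comp_decays_right sep_sub pkg_of_spr)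
open Summit.QuantumFields.BalabanUV.Beta.CombSecondOrderClassStep (locStencil₂_combR2An1_succ)
open Summit.QuantumFields.BalabanUV.Beta.CombSecondOrderClassBase (locStencil₂_T2RecOf_symTablesAn1 locStencil₂_combR2An1_zero)
open Summit.QuantumFields.BalabanUV.Beta.SymMixedRemainderClass (locStencilFM_symRMrAn1)
open Summit.QuantumFields.BalabanUV.Beta.CombChartStepJets (GcombSh decays_GcombSh)
open Summit.QuantumFields.BalabanUV.Beta.DshAn1 (Dsh)
open Summit.QuantumFields.BalabanUV.Beta.SpineRooted (M1Of SpureRecOf T2RecOf locStencil_SpureRecOf vertexFamily_M1Of)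
open Summit.QuantumFields.BalabanUV.Beta.SymShiftedSpread (bhKStepSh spr_bhKStepSh)
open Summit.QuantumFields.BalabanUV.Beta.RelInvNullShift (spr_add)
open Summit.QuantumFields.BalabanUV.Beta.DshAn1 (Dsh spr_Dsh)
open Summit.QuantumFields.BalabanUV.Beta.E3ContactGenerator (ctGenM)
open Summit.QuantumFields.BalabanUV.Beta.SymAveragingHessianCounts (symVhSAt symHessFFAt symVhSAt_hV_ctr symHessFFAt_hH_ctr)
open Summit.QuantumFields.BalabanUV.Beta.SymAveragingMixedJetTables (symMixFFAt)
open Summit.QuantumFields.BalabanUV.Beta.SymSecondOrderTablesAn1 (symVh₂SAn1 symMixFFAt_hmix_ctr)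
open Summit.QuantumFields.BalabanUV.Beta.SymSecondOrderSplitLoc (locStencil_diagK_mul_ctGenM abs_ctGenM_mul_ctGenM_le locStencil₂_diagK_ctGenM_mul_ctGenM)
open Summit.QuantumFields.BalabanUV.Beta.SymSecondOrderDeltaSep (sep_conjW_word sep_diagK_sharpSymbol sep_zeroTable)
open Summit.QuantumFields.BalabanUV.Beta.SymMixedReflectionLetterAn1 (symRMrAn1)
open Summit.QuantumFields.BalabanUV.Beta.CombSecondOrderRemainderAn1 (combΔOfAt combR2An1 combΔAn1)

namespace Summit.QuantumFields.BalabanUV.Beta.CombSecondOrderDeltaSep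

variable {d N : ℕ}

/-! ## §3 The explicit form of the OWNER's split defect at the (0.4) literal -/

section Literal

variable {Lc : ℕ} [NeZero Lc]

/-- [folklore] ONE COMMON RATE for the (0.4) letters at level `j`: the decay of `GcombSh Lc j`, the locality of the pure recursive stencils, the
multiplier tables and the `γ_j`-scaled border-reading generator family. -/
theorem comb_letters_common (cΛ : ℝ) (γ : ℕ → ℝ) (j : ℕ) (α : Fin 4) :
    ∃ m C Cs CM Cg : ℝ, 0 < m ∧ 0 ≤ C ∧ Decays (GcombSh (d := 3) Lc j) C m ∧
      LocStencil (SpureRecOf 3 Lc (symVhSAt (ctr 4 Lc) 3 Lc rfl) (symHessFFAt (ctr 4 Lc) Lc) (GcombSh Lc) ((Lc : ℝ) ^ 4) (-((Lc : ℝ) ^ 8 / 2)) cΛ j) Cs m ∧ VertexFamily (M1Of 3 Lc (symHessFFAt (ctr 4 Lc) Lc) cΛ j) Lc CM m ∧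
      LocStencil (fun κ u => diagK fun p a => γ j * ctGenM 3 (bhK Lc + Dsh Lc) α Lc κ u p a) Cg m := by
  have hL1 : 1 ≤ Lc := one_le_of_neZero Lc
  obtain ⟨δK, C, hδK, hC, hKd⟩ := decays_GcombSh (d := 3) Lc j
  obtain ⟨Cs, δs, hδs, hS⟩ := locStencil_SpureRecOf (d := 3) hL1 (symVhSAt_hV_ctr (d := 3) hL1) (symHessFFAt_hH_ctr (d := 3) hL1)
    (decays_GcombSh Lc) ((Lc : ℝ) ^ 4) (-((Lc : ℝ) ^ 8 / 2)) cΛ j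
  obtain ⟨δB, CB, hδB, hCB, hBd⟩ := pkg_of_spr (spr_add (spr_bhK (d := 3) hL1) (spr_Dsh hL1))
  set m : ℝ := min (min δK δs) (δB / 2) with hm_def
  have hm : 0 < m := lt_min (lt_min hδK hδs) (half_pos hδB)
  have hmK : m ≤ δK := (min_le_left _ _).trans (min_le_left _ _)
  have hms : m ≤ δs := (min_le_left _ _).trans (min_le_right _ _)
  have hmB : m ≤ δB / 2 := min_le_right _ _
  obtain ⟨C1, hH1⟩ := symHessFFAt_hH_ctr (d := 3) hL1 m hm.le
  have hCs : 0 ≤ Cs := (hS 0 0).nonneg (Sum.inl 0)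
  exact ⟨m, C, Cs, _, _, hm, hC, decays_mono hKd hC le_rfl hmK, fun κ u => biLoc_mono (hS κ u) hCs hms, vertexFamily_M1Of hH1 cΛ j,
    fun κ u => biLoc_of_le (locStencil_diagK_mul_ctGenM hBd hδB.le (γ j) α Lc κ u) hmB⟩

/-- [folklore] **THE EXPLICIT FORM OF THE OWNER's SPLIT DEFECT** `CombSecondOrderRemainderAn1.combΔOfAt … j Rj α μ y ν y′` for ANY `LocStencil₂`
remainder family `Rj α`: the sharp second symbol's contact word MINUS the displayed `X2s`-contact word, PLUS the contact-kernel vertex `dM Ξ_c …`, PLUS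
the remainder bi-vertex and the two mixed-remainder vertices (leaf-10's `W2OfK_sharp_split_of_decay` at the (0.4) letters + an2's `W2OfK_add_slot₂`;
the comb twin is leaf-10's `SecondOrderSplitLiteral.W2OfK_sharp_split_literal₂`). -/
theorem combΔOfAt_eq_sharp (N : ℕ) (cΛ : ℝ) (γ : ℕ → ℝ)
    (X2s : ℕ → Fin 4 → Fin 4 → (Fin 4 → ℤ) → Fin 4 → (Fin 4 → ℤ) → (Fin 4 → ℤ) → Fib 3 → ℝ) (j : ℕ)
    {Rj : Fin 4 → Fin 4 → (Fin 4 → ℤ) → Fin 4 → (Fin 4 → ℤ) → MKer 4 (Fib 3)} (α : Fin 4)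
    (hR : ∃ C δ : ℝ, 0 < δ ∧ LocStencil₂ (Rj α) C δ) (μ : Fin 4) (y : Fin 4 → ℤ) (ν : Fin 4) (y' : Fin 4 → ℤ) :
    combΔOfAt Lc N cΛ γ X2s j Rj α μ y ν y' =
      conjW (bhKStepSh 3 Lc (Dsh Lc) j) (dM (GcombSh Lc j) Lc (SpureRecOf 3 Lc (symVhSAt (ctr 4 Lc) 3 Lc rfl) (symHessFFAt (ctr 4 Lc) Lc) (GcombSh Lc) ((Lc : ℝ) ^ 4) (-((Lc : ℝ) ^ 8 / 2)) cΛ j) (M1Of 3 Lc (symHessFFAt (ctr 4 Lc) Lc) cΛ j) μ y) (dM (GcombSh Lc j) Lc (SpureRecOf 3 Lc (symVhSAt (ctr 4 Lc) 3 Lc rfl) (symHessFFAt (ctr 4 Lc) Lc) (GcombSh Lc) ((Lc : ℝ) ^ 4) (-((Lc : ℝ) ^ 8 / 2)) cΛ j) (M1Of 3 Lc (symHessFFAt (ctr 4 Lc) Lc) cΛ j) ν y') (diagK fun p c => ∑ κ, ∑' u, colH (GcombSh Lc j) Lc μ y κ u * (γ j * ctGenM 3 (bhK Lc + Dsh Lc)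 α Lc κ u p c))
          (diagK fun p c => ∑ κ', ∑' u', colH (GcombSh Lc j) Lc ν y' κ' u' * (γ j * ctGenM 3 (bhK Lc + Dsh Lc) α Lc κ' u' p c)) (diagK fun p c => (∑ κ, ∑' u, colH (GcombSh Lc j) Lc μ y κ u * ∑ κ', ∑' u', colH (GcombSh Lc j) Lc ν y' κ' u' * ((γ j * ctGenM 3 (bhK Lc + Dsh Lc) α Lc κ u p c) * (γ j * ctGenM 3 (bhK Lc + Dsh Lc) α Lc κ' u' p c))) + ∑ κ, ∑' u, colH (K2OfK (GcombSh Lc j) Lc (SpureRecOf 3 Lc (symVhSAt (ctr 4 Lc) 3 Lc rfl) (symHessFFAt (ctr 4 Lc) Lc) (GcombSh Lc) ((Lc : ℝ) ^ 4) (-((Lc : ℝ) ^ 8 / 2)) cΛ j) (M1Of 3 Lc (symHessFFAt (ctr 4 Lc) Lc) cΛ j) ν y' + (-(comp (comp (GcombSh Lc j) (conjV (bhKStepSh 3 Lc (Dsh Lc) j) (diagK fun p c => ∑ κ, ∑' u, colH (GcombSh Lc j) Lc ν y' κ u * (γ j * ctGenM 3 (bhK Lc + Dsh Lc) α Lc κ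 u p c)))) (GcombSh Lc j)))) Lc μ y κ u * (γ j * ctGenM 3 (bhK Lc + Dsh Lc) α Lc κ u p c)) +
        dM (-(comp (comp (GcombSh Lc j) (conjV (bhKStepSh 3 Lc (Dsh Lc) j) (diagK fun p c => ∑ κ, ∑' u, colH (GcombSh Lc j) Lc ν y' κ u * (γ j * ctGenM 3 (bhK Lc + Dsh Lc) α Lc κ u p c)))) (GcombSh Lc j))) Lc (SpureRecOf 3 Lc (symVhSAt (ctr 4 Lc) 3 Lc rfl) (symHessFFAt (ctr 4 Lc) Lc) (GcombSh Lc) ((Lc : ℝ) ^ 4) (-((Lc : ℝ) ^ 8 / 2)) cΛ j) (M1Of 3 Lc (symHessFFAt (ctr 4 Lc) Lc) cΛ j) μ y +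
        (vertex2OfK (GcombSh Lc j) Lc (Rj α) μ y ν y' +
          (mixOfK (GcombSh Lc j) Lc (symRMrAn1 Lc cΛ γ j α) μ y ν y' + mixOfK (GcombSh Lc j) Lc (symRMrAn1 Lc cΛ γ j α) ν y' μ y)) -
        conjW (bhKStepSh 3 Lc (Dsh Lc) j) (dM (GcombSh Lc j) Lc (SpureRecOf 3 Lc (symVhSAt (ctr 4 Lc) 3 Lc rfl) (symHessFFAt (ctr 4 Lc) Lc) (GcombSh Lc) ((Lc : ℝ) ^ 4) (-((Lc : ℝ) ^ 8 / 2)) cΛ j) (M1Of 3 Lc (symHessFFAt (ctr 4 Lc) Lc) cΛ j) μ y) (dM (GcombSh Lc j) Lc (SpureRecOf 3 Lc (symVhSAt (ctr 4 Lc) 3 Lc rfl) (symHessFFAt (ctr 4 Lc) Lc) (GcombSh Lc) ((Lc : ℝ) ^ 4) (-((Lc : ℝ) ^ 8 / 2)) cΛ j) (M1Of 3 Lc (symHessFFAt (ctr 4 Lc) Lc) cΛ j) ν y') (diagK fun p c => ∑ κ, ∑' u, colH (GcombSh Lc j) Lc μ y κ u * (γ j * ctGenM 3 (bhK Lc + Dsh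 Lc) α Lc κ u p c)) (diagK fun p c => ∑ κ, ∑' u, colH (GcombSh Lc j) Lc ν y' κ u * (γ j * ctGenM 3 (bhK Lc + Dsh Lc) α Lc κ u p c)) (diagK (X2s j α μ y ν y')) := by
  have hL1 : 1 ≤ Lc := one_le_of_neZero Lc
  obtain ⟨m, C, Cs, CM, Cg, hm, hC, hG, hS, hM, hgl⟩ := comb_letters_common (Lc := Lc) cΛ γ j α
  have hK : ∃ δ C : ℝ, 0 < δ ∧ 0 ≤ C ∧ Decays (GcombSh (d := 3) Lc j) C δ := ⟨m, C, hm, hC, hG⟩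
  obtain ⟨δB, CB, hδB, hCB, hBd⟩ := pkg_of_spr (spr_add (spr_bhK (d := 3) hL1) (spr_Dsh hL1))
  have hhb := abs_ctGenM_mul_ctGenM_le hBd hδB.le (γ j) (γ j) α Lc
  obtain ⟨B₂, δ₂, hδ₂, hT₂⟩ := locStencil₂_T2RecOf_symTablesAn1 (Lc := Lc) N cΛ j
  obtain ⟨CMx, δM, hδM, hMx⟩ := symMixFFAt_hmix_ctr (d := 3) hL1
  obtain ⟨C₂, δR, hδR, hR₂⟩ := hR
  obtain ⟨CR, δRM, hδRM, hRMl⟩ := locStencilFM_symRMrAn1 (Lc := Lc) cΛ γ j α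
  have hB₂ : ∀ κ u κ' u' x z a b, |(T2RecOf 3 Lc (GcombSh Lc) (SpureRecOf 3 Lc (symVhSAt (ctr 4 Lc) 3 Lc rfl) (symHessFFAt (ctr 4 Lc) Lc) (GcombSh Lc) ((Lc : ℝ) ^ 4) (-((Lc : ℝ) ^ 8 / 2)) cΛ) (M1Of 3 Lc (symHessFFAt (ctr 4 Lc) Lc) cΛ) ((Lc : ℝ) ^ 8) (-((Lc : ℝ) ^ 12 / 4)) ((8 * (N : ℝ) ^ 2)⁻¹ • wsym22 N) (symVh₂SAn1 3 Lc) (symMixFFAt (ctr 4 Lc) Lc) j) κ u κ' u' x z a b| ≤ B₂ := fun κ u κ' u' x z a b => abs_le_of_locStencil₂ hT₂ hδ₂.le κ u κ' u' x z a b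
  have hR₂b : ∀ κ u κ' u' x z a b, |Rj α κ u κ' u' x z a b| ≤ C₂ := fun κ u κ' u' x z a b => abs_le_of_locStencil₂ hR₂ hδR.le κ u κ' u' x z a b
  have hBM : ∀ κ u ρ w x z a b, |(M2Of 3 Lc (symMixFFAt (ctr 4 Lc) Lc) j) κ u ρ w x z a b| ≤ |BalabanStepW2.wM2 3 Lc j| * CMx :=
    fun κ u ρ w x z a b => abs_le_of_locStencilFM (locStencilFM_M2Of hMx j) hδM.le κ u ρ w x z a b
  have hRMb : ∀ κ u ρ w x z a b, |symRMrAn1 Lc cΛ γ j α κ u ρ w x z a b| ≤ CR :=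
    fun κ u ρ w x z a b => abs_le_of_locStencilFM hRMl hδRM.le κ u ρ w x z a b
  have hB₂' : ∀ κ u κ' u' x z a b, |((T2RecOf 3 Lc (GcombSh Lc) (SpureRecOf 3 Lc (symVhSAt (ctr 4 Lc) 3 Lc rfl) (symHessFFAt (ctr 4 Lc) Lc) (GcombSh Lc) ((Lc : ℝ) ^ 4) (-((Lc : ℝ) ^ 8 / 2)) cΛ) (M1Of 3 Lc (symHessFFAt (ctr 4 Lc) Lc) cΛ) ((Lc : ℝ) ^ 8) (-((Lc : ℝ) ^ 12 / 4)) ((8 * (N : ℝ) ^ 2)⁻¹ • wsym22 N) (symVh₂SAn1 3 Lc) (symMixFFAt (ctr 4 Lc) Lc) j) κ u κ' u' + Rj α κ u κ' u') x z a b| ≤ B₂ + C₂ := fun κ u κ' u' x z a b => by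
    rw [Pi.add_apply, Pi.add_apply, Pi.add_apply, Pi.add_apply]
    exact (abs_add_le _ _).trans (add_le_add (hB₂ κ u κ' u' x z a b) (hR₂b κ u κ' u' x z a b))
  have hBM' : ∀ κ u ρ w x z a b, |((M2Of 3 Lc (symMixFFAt (ctr 4 Lc) Lc) j) κ u ρ w + symRMrAn1 Lc cΛ γ j α κ u ρ w) x z a b| ≤ |BalabanStepW2.wM2 3 Lc j| * CMx + CR :=
    fun κ u ρ w x z a b => by
      rw [Pi.add_apply, Pi.add_apply, Pi.add_apply, Pi.add_apply]
      exact (abs_add_le _ _).trans (add_le_add (hBM κ u ρ w x z a b) (hRMb κ u ρ w x z a b))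
  unfold CombSecondOrderRemainderAn1.combΔOfAt
  -- regroup both remainders next to the plain tables
  rw [show (fun κ u κ' u' => (T2RecOf 3 Lc (GcombSh Lc) (SpureRecOf 3 Lc (symVhSAt (ctr 4 Lc) 3 Lc rfl) (symHessFFAt (ctr 4 Lc) Lc) (GcombSh Lc) ((Lc : ℝ) ^ 4) (-((Lc : ℝ) ^ 8 / 2)) cΛ) (M1Of 3 Lc (symHessFFAt (ctr 4 Lc) Lc) cΛ) ((Lc : ℝ) ^ 8) (-((Lc : ℝ) ^ 12 / 4)) ((8 * (N : ℝ) ^ 2)⁻¹ • wsym22 N) (symVh₂SAn1 3 Lc) (symMixFFAt (ctr 4 Lc) Lc) j) κ u κ' u' +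
          conjW (bhKStepSh 3 Lc (Dsh Lc) j) ((SpureRecOf 3 Lc (symVhSAt (ctr 4 Lc) 3 Lc rfl) (symHessFFAt (ctr 4 Lc) Lc) (GcombSh Lc) ((Lc : ℝ) ^ 4) (-((Lc : ℝ) ^ 8 / 2)) cΛ j) κ u) ((SpureRecOf 3 Lc (symVhSAt (ctr 4 Lc) 3 Lc rfl) (symHessFFAt (ctr 4 Lc) Lc) (GcombSh Lc) ((Lc : ℝ) ^ 4) (-((Lc : ℝ) ^ 8 / 2)) cΛ j) κ' u')
            (diagK fun p c => γ j * ctGenM 3 (bhK Lc + Dsh Lc) α Lc κ u p c) (diagK fun p c => γ j * ctGenM 3 (bhK Lc + Dsh Lc) α Lc κ' u' p c) (diagK fun p c => (γ j * ctGenM 3 (bhK Lc + Dsh Lc) α Lc κ u p c) * (γ j * ctGenM 3 (bhK Lc + Dsh Lc) α Lc κ' u' p c)) +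
          Rj α κ u κ' u') =
        (fun κ u κ' u' => ((T2RecOf 3 Lc (GcombSh Lc) (SpureRecOf 3 Lc (symVhSAt (ctr 4 Lc) 3 Lc rfl) (symHessFFAt (ctr 4 Lc) Lc) (GcombSh Lc) ((Lc : ℝ) ^ 4) (-((Lc : ℝ) ^ 8 / 2)) cΛ) (M1Of 3 Lc (symHessFFAt (ctr 4 Lc) Lc) cΛ) ((Lc : ℝ) ^ 8) (-((Lc : ℝ) ^ 12 / 4)) ((8 * (N : ℝ) ^ 2)⁻¹ • wsym22 N) (symVh₂SAn1 3 Lc) (symMixFFAt (ctr 4 Lc) Lc) j) κ u κ' u' + Rj α κ u κ' u') +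
          conjW (bhKStepSh 3 Lc (Dsh Lc) j) ((SpureRecOf 3 Lc (symVhSAt (ctr 4 Lc) 3 Lc rfl) (symHessFFAt (ctr 4 Lc) Lc) (GcombSh Lc) ((Lc : ℝ) ^ 4) (-((Lc : ℝ) ^ 8 / 2)) cΛ j) κ u) ((SpureRecOf 3 Lc (symVhSAt (ctr 4 Lc) 3 Lc rfl) (symHessFFAt (ctr 4 Lc) Lc) (GcombSh Lc) ((Lc : ℝ) ^ 4) (-((Lc : ℝ) ^ 8 / 2)) cΛ j) κ' u')
            (diagK fun p c => γ j * ctGenM 3 (bhK Lc + Dsh Lc) α Lc κ u p c) (diagK fun p c => γ j * ctGenM 3 (bhK Lc + Dsh Lc) α Lc κ' u' p c) (diagK fun p c => (γ j * ctGenM 3 (bhK Lc + Dsh Lc) α Lc κ u p c) * (γ j * ctGenM 3 (bhK Lc + Dsh Lc) α Lc κ' u' p c)))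
      from funext fun κ => funext fun u => funext fun κ' => funext fun u' => add_right_comm _ _ _,
    show (fun κ u ρ w => (M2Of 3 Lc (symMixFFAt (ctr 4 Lc) Lc) j) κ u ρ w + conjV ((M1Of 3 Lc (symHessFFAt (ctr 4 Lc) Lc) cΛ j) ρ w) (diagK fun p c => γ j * ctGenM 3 (bhK Lc + Dsh Lc) α Lc κ u p c) +
          symRMrAn1 Lc cΛ γ j α κ u ρ w) =
        (fun κ u ρ w => ((M2Of 3 Lc (symMixFFAt (ctr 4 Lc) Lc) j) κ u ρ w + symRMrAn1 Lc cΛ γ j α κ u ρ w) +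
          conjV ((M1Of 3 Lc (symHessFFAt (ctr 4 Lc) Lc) cΛ j) ρ w) (diagK fun p c => γ j * ctGenM 3 (bhK Lc + Dsh Lc) α Lc κ u p c))
      from funext fun κ => funext fun u => funext fun ρ => funext fun w => add_right_comm _ _ _]
  rw [W2OfK_sharp_split_of_decay (N := Lc) hG hC hm (spr_bhKStepSh (spr_Dsh hL1) j) hS hM
      (S₂ := fun κ u κ' u' => (T2RecOf 3 Lc (GcombSh Lc) (SpureRecOf 3 Lc (symVhSAt (ctr 4 Lc) 3 Lc rfl) (symHessFFAt (ctr 4 Lc) Lc) (GcombSh Lc) ((Lc : ℝ) ^ 4) (-((Lc : ℝ) ^ 8 / 2)) cΛ) (M1Of 3 Lc (symHessFFAt (ctr 4 Lc) Lc) cΛ) ((Lc : ℝ) ^ 8) (-((Lc : ℝ) ^ 12 / 4)) ((8 * (N : ℝ) ^ 2)⁻¹ • wsym22 N) (symVh₂SAn1 3 Lc) (symMixFFAt (ctr 4 Lc) Lc) j) κ u κ' u' + Rj α κ u κ' u')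
      (M₂ := fun κ u ρ w => (M2Of 3 Lc (symMixFFAt (ctr 4 Lc) Lc) j) κ u ρ w + symRMrAn1 Lc cΛ γ j α κ u ρ w) hB₂' hBM' hgl hhb μ y ν y',
    W2OfK_add_slot₂ hK _ _ hB₂ hR₂b hBM hRMb μ y ν y']
  abel

/-! ## §4 THE Δ-HALF OF THE CLASS STEP: the OWNER's signature -/

/-- [folklore] **`combΔAn1 … j α` IS SEPARATION-LOCALISED FROM THE CLASSES OF `X2s j α` AND `combR2An1 … j α`** — the row-D1 OWNER's requested
signature (R-D1-g33-0): `hX` in the currency of `CombSecondOrderClassStep.locStencil₂_combR2An1_succ` and the conclusion = its `hΔ`.  By §3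
(with `Rj := combR2An1 … j`), §1 twice (the two contact words: sharp symbol by §2, displayed symbol by `hX`), leaf-05's `sep_dM_of_vertexFamily`
(over `vertexFamily_Xi`), `sep_vertex2OfK` (`hR2`), `sep_mixOfK ∕ _swap` (`SymMixedRemainderClass.locStencilFM_symRMrAn1`). -/
theorem sep_combΔAn1_of_classes (N : ℕ) (cΛ : ℝ) (γ : ℕ → ℝ)
    (X2s : ℕ → Fin 4 → Fin 4 → (Fin 4 → ℤ) → Fin 4 → (Fin 4 → ℤ) → (Fin 4 → ℤ) → Fib 3 → ℝ) (j : ℕ) (α : Fin 4)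
    (hX : ∃ C δ : ℝ, 0 < δ ∧ ∀ μ y ν y', BiLoc (diagK (X2s j α μ y ν y')) ((Lc : ℤ) • y) ((Lc : ℤ) • y)
      (C * Real.exp (-δ * l1 ((Lc : ℤ) • y - (Lc : ℤ) • y'))) δ)
    (hR2 : ∃ C δ : ℝ, 0 < δ ∧ LocStencil₂ (combR2An1 Lc N cΛ γ X2s j α) C δ) :
    ∃ C δ : ℝ, 0 < δ ∧ ∀ μ y ν y', BiLoc (combΔAn1 Lc N cΛ γ X2s j α μ y ν y') ((Lc : ℤ) • y) ((Lc : ℤ) • y)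
      (C * Real.exp (-δ * l1 ((Lc : ℤ) • y - (Lc : ℤ) • y'))) δ := by
  have hL1 : 1 ≤ Lc := one_le_of_neZero Lc
  obtain ⟨m, C, Cs, CM, Cg, hm, hC, hG, hS, hM, hgl⟩ := comb_letters_common (Lc := Lc) cΛ γ j α
  have hK : ∃ δ C : ℝ, 0 < δ ∧ 0 ≤ C ∧ Decays (GcombSh (d := 3) Lc j) C δ := ⟨m, C, hm, hC, hG⟩
  have h𝕄 : ∃ δ C : ℝ, 0 < δ ∧ 0 ≤ C ∧ Decays (bhKStepSh 3 Lc (Dsh Lc) j) C δ := pkg_of_spr (spr_bhKStepSh (spr_Dsh hL1) j)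
  have hS' : ∃ Cs δs : ℝ, 0 < δs ∧ LocStencil (SpureRecOf 3 Lc (symVhSAt (ctr 4 Lc) 3 Lc rfl) (symHessFFAt (ctr 4 Lc) Lc) (GcombSh Lc) ((Lc : ℝ) ^ 4) (-((Lc : ℝ) ^ 8 / 2)) cΛ j) Cs δs := ⟨Cs, m, hm, hS⟩
  have hM' : ∃ CM δM : ℝ, 0 < δM ∧ VertexFamily (M1Of 3 Lc (symHessFFAt (ctr 4 Lc) Lc) cΛ j) Lc CM δM := ⟨CM, m, hm, hM⟩
  have hgl' : ∃ Cg δg : ℝ, 0 < δg ∧ LocStencil (fun κ u => diagK fun p a => γ j * ctGenM 3 (bhK Lc + Dsh Lc) α Lc κ u p a) Cg δg := ⟨Cg, m, hm, hgl⟩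
  obtain ⟨δB, CB, hδB, hCB, hBd⟩ := pkg_of_spr (spr_add (spr_bhK (d := 3) hL1) (spr_Dsh hL1))
  have hhl : ∃ Ch δh : ℝ, 0 < δh ∧ LocStencil₂ (fun κ u κ' u' => diagK fun p a =>
      (γ j * ctGenM 3 (bhK Lc + Dsh Lc) α Lc κ u p a) * (γ j * ctGenM 3 (bhK Lc + Dsh Lc) α Lc κ' u' p a)) Ch δh :=
    ⟨_, δB / 3, by positivity, locStencil₂_diagK_ctGenM_mul_ctGenM hBd hδB.le (γ j) (γ j) α Lc⟩
  -- the vertex families entering the two contact words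
  have hA := vertexFamily_dM' (N := Lc) hK hS' hM'
  have hD := vertexFamily_dressedGen (N := Lc) hK hgl'
  -- the pieces
  have wS := sep_conjW_word (N := Lc) h𝕄 hA hD (sep_diagK_sharpSymbol (N := Lc) hK h𝕄 hS' hM' hgl' hhl)
  have w₀ := sep_conjW_word (N := Lc) h𝕄 hA hD hX
  have wΞ := sep_dM_of_vertexFamily (N := Lc) (vertexFamily_Xi (N := Lc) hK h𝕄 hgl') hS' hM'
  have wR := sep_vertex2OfK (N := Lc) hK hR2
  have wM := sep_mixOfK (N := Lc) hK (locStencilFM_symRMrAn1 (Lc := Lc) cΛ γ j α)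
  have wM' := sep_mixOfK_swap (N := Lc) hK (locStencilFM_symRMrAn1 (Lc := Lc) cΛ γ j α)
  have h := sep_sub (sep_add (sep_add wS wΞ) (sep_add wR (sep_add wM wM'))) w₀
  obtain ⟨C', δ', hδ', h'⟩ := h
  refine ⟨C', δ', hδ', fun μ y ν y' => ?_⟩
  have e : combΔAn1 Lc N cΛ γ X2s j α μ y ν y' = combΔOfAt Lc N cΛ γ X2s j (combR2An1 Lc N cΛ γ X2s j) α μ y ν y' := rfl
  rw [e, combΔOfAt_eq_sharp (Lc := Lc) N cΛ γ X2s j (Rj := combR2An1 Lc N cΛ γ X2s j) α hR2 μ y ν y']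
  exact h' μ y ν y'

/-! ## §5 THE CLASS INDUCTION and ROOT L∕M's `hΔL` -/

/-- [folklore] **THE TWO-CLASS INDUCTION**: if the free table `X2s · α` is separation-localised at every level, then at every level `j` the OWNER's
recursive remainder `combR2An1 … j α` is `LocStencil₂` AND the split defect `combΔAn1 … j α` is separation-localised (base
`CombSecondOrderClassBase.locStencil₂_combR2An1_zero`; step `CombSecondOrderClassStep.locStencil₂_combR2An1_succ` + §4). -/
theorem classes_combR2An1_combΔAn1 (N : ℕ) (cΛ : ℝ) (γ : ℕ → ℝ)
    (X2s : ℕ → Fin 4 → Fin 4 → (Fin 4 → ℤ) → Fin 4 → (Fin 4 → ℤ) → (Fin 4 → ℤ) → Fib 3 → ℝ) (α : Fin 4)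
    (hX : ∀ j : ℕ, ∃ C δ : ℝ, 0 < δ ∧ ∀ μ y ν y', BiLoc (diagK (X2s j α μ y ν y')) ((Lc : ℤ) • y) ((Lc : ℤ) • y)
      (C * Real.exp (-δ * l1 ((Lc : ℤ) • y - (Lc : ℤ) • y'))) δ) :
    ∀ j : ℕ, (∃ C δ : ℝ, 0 < δ ∧ LocStencil₂ (combR2An1 Lc N cΛ γ X2s j α) C δ) ∧
      (∃ C δ : ℝ, 0 < δ ∧ ∀ μ y ν y', BiLoc (combΔAn1 Lc N cΛ γ X2s j α μ y ν y') ((Lc : ℤ) • y) ((Lc : ℤ) • y)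
        (C * Real.exp (-δ * l1 ((Lc : ℤ) • y - (Lc : ℤ) • y'))) δ)
  | 0 => by
    have h0 := locStencil₂_combR2An1_zero (Lc := Lc) N cΛ γ X2s α
    exact ⟨h0, sep_combΔAn1_of_classes N cΛ γ X2s 0 α (hX 0) h0⟩
  | j + 1 => by
    obtain ⟨hRj, hΔj⟩ := classes_combR2An1_combΔAn1 N cΛ γ X2s α hX j
    have hR := locStencil₂_combR2An1_succ (Lc := Lc) N cΛ γ X2s j α (hX j) hΔj
    exact ⟨hR, sep_combΔAn1_of_classes N cΛ γ X2s (j + 1) α (hX (j + 1)) hR⟩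

/-- [folklore] Corollary: every `combR2An1 … j α` is a `LocStencil₂` family. -/
theorem locStencil₂_combR2An1 (N : ℕ) (cΛ : ℝ) (γ : ℕ → ℝ)
    (X2s : ℕ → Fin 4 → Fin 4 → (Fin 4 → ℤ) → Fin 4 → (Fin 4 → ℤ) → (Fin 4 → ℤ) → Fib 3 → ℝ) (α : Fin 4)
    (hX : ∀ j : ℕ, ∃ C δ : ℝ, 0 < δ ∧ ∀ μ y ν y', BiLoc (diagK (X2s j α μ y ν y')) ((Lc : ℤ) • y) ((Lc : ℤ) • y)
      (C * Real.exp (-δ * l1 ((Lc : ℤ) • y - (Lc : ℤ) • y'))) δ) (j : ℕ) :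
    ∃ C δ : ℝ, 0 < δ ∧ LocStencil₂ (combR2An1 Lc N cΛ γ X2s j α) C δ :=
  (classes_combR2An1_combΔAn1 N cΛ γ X2s α hX j).1

/-- [folklore] Corollary: every `combΔAn1 … j α` is separation-localised. -/
theorem sep_combΔAn1 (N : ℕ) (cΛ : ℝ) (γ : ℕ → ℝ)
    (X2s : ℕ → Fin 4 → Fin 4 → (Fin 4 → ℤ) → Fin 4 → (Fin 4 → ℤ) → (Fin 4 → ℤ) → Fib 3 → ℝ) (α : Fin 4)
    (hX : ∀ j : ℕ, ∃ C δ : ℝ, 0 < δ ∧ ∀ μ y ν y', BiLoc (diagK (X2s j α μ y ν y')) ((Lc : ℤ) • y) ((Lc : ℤ) • y)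
      (C * Real.exp (-δ * l1 ((Lc : ℤ) • y - (Lc : ℤ) • y'))) δ) (j : ℕ) :
    ∃ C δ : ℝ, 0 < δ ∧ ∀ μ y ν y', BiLoc (combΔAn1 Lc N cΛ γ X2s j α μ y ν y') ((Lc : ℤ) • y) ((Lc : ℤ) • y)
      (C * Real.exp (-δ * l1 ((Lc : ℤ) • y - (Lc : ℤ) • y'))) δ :=
  (classes_combR2An1_combΔAn1 N cΛ γ X2s α hX j).2

/-- [folklore] **ROOT L's BINDER `hΔL` UNDER THE `X2s` CLASS** (pointwise localisation of the defined split defect): if `X2s j α` is separation-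
localised for all `j`, `α`, then `Loc (combΔAn1 … j α μ y ν y′)` for all `j α μ y ν y′`. -/
theorem loc_combΔAn1 (N : ℕ) (cΛ : ℝ) (γ : ℕ → ℝ)
    (X2s : ℕ → Fin 4 → Fin 4 → (Fin 4 → ℤ) → Fin 4 → (Fin 4 → ℤ) → (Fin 4 → ℤ) → Fib 3 → ℝ)
    (hX : ∀ (j : ℕ) (α : Fin 4), ∃ C δ : ℝ, 0 < δ ∧ ∀ μ y ν y', BiLoc (diagK (X2s j α μ y ν y')) ((Lc : ℤ) • y) ((Lc : ℤ) • y)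
      (C * Real.exp (-δ * l1 ((Lc : ℤ) • y - (Lc : ℤ) • y'))) δ) :
    ∀ (j : ℕ) (α μ : Fin 4) (y : Fin 4 → ℤ) (ν : Fin 4) (y' : Fin 4 → ℤ), Loc (combΔAn1 Lc N cΛ γ X2s j α μ y ν y') := by
  intro j α μ y ν y'
  obtain ⟨C, δ, hδ, h⟩ := sep_combΔAn1 (Lc := Lc) N cΛ γ X2s α (fun j => hX j α) j
  exact ⟨_, _, _, δ, hδ, h μ y ν y'⟩

/-- [folklore] **ROOT M's BINDER `hΔL` — UNCONDITIONALLY**: at the pin `X2s := 0` the `X2s` class is trivial, so for EVERY `N`, `cΛ`, `γ` and all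
`j α μ y ν y′`, `Loc (combΔAn1 Lc N cΛ γ 0 j α μ y ν y′)` (in particular at ROOT M's displayed `γ`). -/
theorem hΔL_pinned (N : ℕ) (cΛ : ℝ) (γ : ℕ → ℝ) :
    ∀ (j : ℕ) (α μ : Fin 4) (y : Fin 4 → ℤ) (ν : Fin 4) (y' : Fin 4 → ℤ),
      Loc (combΔAn1 Lc N cΛ γ (0 : ℕ → Fin 4 → Fin 4 → (Fin 4 → ℤ) → Fin 4 → (Fin 4 → ℤ) → (Fin 4 → ℤ) → Fib 3 → ℝ) j α μ y ν y') :=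
  loc_combΔAn1 (Lc := Lc) N cΛ γ 0 (sep_zeroTable (Lc := Lc))

end Literal

end Summit.QuantumFields.BalabanUV.Beta.CombSecondOrderDeltaSep

end
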